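import Mathlib
import Summits.MatrixMultiplication.MatrixMultiplication.Theorems.LieRankDesigns.Negative.Basics
import Summits.MatrixMultiplication.MatrixMultiplication.Theorems.LieRankDesigns.Negative.Walls
import Summits.MatrixMultiplication.MatrixMultiplication.Theorems.LevelGradedCohnUmansLieRankDesignsStubLevelOfFixedVector
import Summits.MatrixMultiplication.MatrixMultiplication.Theorems.SubgroupIdentityDesigns.Negative.BorelLevelOne

/-!
# Block slices, V: the slice `S_{m,1}` carries a level-ONE identity design — every `m`, every `p`
# (BLOCK-SLICES Theorem 1.2 for `k = 1`, kernel-checked)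

Positive-side structure theorem for the crux `SubgroupIdentityDesigns` (stmt-MatrixMultiplication-14079),
route `LevelGradedCohnUmans`; companion of `BlockSliceNoGo` / `BlockSliceConditional` (the packing no-go).
VALUE = theorem, NOT summit progress (the crux item stays open).

Write `m = 1 + l` and let `S = S_{m,1} = {g ∈ GL_m(𝔽_p) : lower-right l × l block of g is 1}` (`slice`,
literally the slice hypothesis of `BlockSliceConditional.volume_lt_cube` at `k = 1`).  With the probe vectors
`x_u = (1 ; u)`, `u ∈ 𝔽_p^l`, and the fibre indicators `[g x = y]` (level `≤ 1`:
`BorelLevelOne.frameIndicator_mem_levelSet`), put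
`F(g) = Σ_u ([g x_u = (1 ; u)] − [g x_u = (0 ; u)])`,  `f = p^{-l} F`.
* `f_mem` — `f ∈ F_1` (the crux's level-`≤ 1` set `levelSet p (1 + l) 1`);
* `f_one` — `f(1) = 1`;  `f_eq_zero` — `f(g) = 0` for `g ∈ S ∖ {1}`.
  (For `g = (a b; c 1) ∈ S`: `g x_u = (a + b·u ; c + u)`, so both indicators vanish unless `c = 0`; if `c = 0`
  and `b = 0` then `a ≠ 0` and the terms are `[a = 1] − [a = 0] = [g = 1]`; if `b ≠ 0` the translation
  `u ↦ u + u₀`, `b·u₀ = 1`, matches the two counts `#{u : a + b·u = 1} = #{u : a + b·u = 0}`.)  This is the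
  case `k = 1` of BLOCK-SLICES Thm 1.2 (`κ = δ₁ − δ₀`), for ALL `m` and `p` (the tree had `m = 2` only:
  `FamilyADesign`, `FamilyAInterp`).
* `design_of_slice`, `design_of_conjSlice` — consequently EVERY triple `H₁ H₂ H₃ ≤ GL_{1+l}(𝔽_p)` whose triple
  products lie in `S` (or in a conjugate `x S x⁻¹`) satisfies the identity-test clause of the crux at level
  `k = 1`, verbatim.  Together with `BlockSliceConditional.not_budget_lt_of_slice_eps` (same slice hypothesis,
  `k = 1`, `l ≥ 3`): on block slices the design is free and the budget inequality is what fails.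
-/

set_option linter.dupNamespace false

noncomputable section

open scoped BigOperators Matrix
open Summit.MatrixMultiplication.MatrixMultiplication.Theorems.LieRankDesigns.Negative
  (GLm Mat fourierFn RankSupp levelSet levelSet_transl)
open Summit.MatrixMultiplication.MatrixMultiplication.Theorems.LieRankDesigns.LevelOfFixedVector
  (add_mem_levelSet smul_mem_levelSet sum_mem_levelSet)

namespace Summit.MatrixMultiplication.MatrixMultiplication.Theorems.SubgroupIdentityDesigns.Negative
namespace BlockSliceDesignOne

variable {p : ℕ} [hp : Fact p.Prime] {l : ℕ}

/-! ## The slice, the probe vectors, the design function -/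

/-- The index `0` of `Fin (1 + l)`. -/
abbrev i0 : Fin (1 + l) := Fin.castAdd l (0 : Fin 1)

/-- The block slice `S_{1+l,1}`: the lower-right `l × l` block (rows and columns `1 … l`) is the identity. -/
def slice : Set (GLm p (1 + l)) :=
  {g | ∀ i j : Fin l, (g : Mat p (1 + l)) (Fin.natAdd 1 i) (Fin.natAdd 1 j) =
    (1 : Matrix (Fin l) (Fin l) (ZMod p)) i j}

/-- Membership in the slice, unfolded. -/
theorem mem_slice {g : GLm p (1 + l)} : g ∈ (slice : Set (GLm p (1 + l))) ↔
    ∀ i j : Fin l, (g : Mat p (1 + l)) (Fin.natAdd 1 i) (Fin.natAdd 1 j) =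
      (1 : Matrix (Fin l) (Fin l) (ZMod p)) i j := Iff.rfl

/-- The probe / target vectors `(N ; u) ∈ 𝔽_p^{1+l}`. -/
def vec (N : ZMod p) (u : Fin l → ZMod p) : Fin (1 + l) → ZMod p :=
  Fin.append (fun _ : Fin 1 => N) u

/-- The fibre indicator `g ↦ [g x = y]`. -/
def fib (x y : Fin (1 + l) → ZMod p) (g : GLm p (1 + l)) : ℂ :=
  if (g : Mat p (1 + l)) *ᵥ x = y then 1 else 0

/-- `F(g) = Σ_u ([g (1;u) = (1;u)] − [g (1;u) = (0;u)])` (`= p^l · f`). -/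
def F (g : GLm p (1 + l)) : ℂ :=
  ∑ u : Fin l → ZMod p, (fib (vec 1 u) (vec 1 u) g - fib (vec 1 u) (vec 0 u) g)

/-- The universal level-one design function on the slice: `f = p^{-l} F`. -/
def f (g : GLm p (1 + l)) : ℂ := (((p : ℂ) ^ l)⁻¹) * F g

/-! ## Level -/

/-- Fibre indicators are level-`≤ 1` functions (a frame indicator with a one-column frame). -/
theorem fib_mem (x y : Fin (1 + l) → ZMod p) : (fib x y : GLm p (1 + l) → ℂ) ∈ levelSet p (1 + l) 1 := by
  have h := frameIndicator_mem_levelSet (p := p) (Matrix.replicateCol (Fin 1) x)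
    (Matrix.replicateCol (Fin 1) y)
  have e : (fib x y : GLm p (1 + l) → ℂ) = fun g : GLm p (1 + l) =>
      if (g : Mat p (1 + l)) * Matrix.replicateCol (Fin 1) x = Matrix.replicateCol (Fin 1) y
      then (1 : ℂ) else 0 := by
    funext g
    simp only [fib, ← Matrix.replicateCol_mulVec, Matrix.replicateCol_inj]
  rw [e]
  exact h

/-- `F` is a level-`≤ 1` function. -/
theorem F_mem : (F : GLm p (1 + l) → ℂ) ∈ levelSet p (1 + l) 1 :=
  sum_mem_levelSet Finset.univ _ fun _ _ => sub_mem_levelSet (fib_mem _ _) (fib_mem _ _)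

/-- `f` is a level-`≤ 1` function. -/
theorem f_mem : (f : GLm p (1 + l) → ℂ) ∈ levelSet p (1 + l) 1 :=
  smul_mem_levelSet F_mem _

/-! ## Values -/

omit hp in
/-- Coordinates of the probe vectors. -/
@[simp] theorem vec_castAdd (N : ZMod p) (u : Fin l → ZMod p) (i : Fin 1) :
    vec N u (Fin.castAdd l i) = N := by
  simp [vec]

omit hp in
/-- Coordinates of the probe vectors. -/
@[simp] theorem vec_natAdd (N : ZMod p) (u : Fin l → ZMod p) (i : Fin l) :
    vec N u (Fin.natAdd 1 i) = u i := by
  simp [vec]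

/-- `(1;u) ≠ (0;u)`. -/
theorem vec_one_ne_vec_zero (u : Fin l → ZMod p) : vec (1 : ZMod p) u ≠ vec 0 u := by
  intro h
  have := congr_fun h i0
  simp only [i0, vec_castAdd] at this
  exact one_ne_zero this

/-- The first row `b` of `g` (off the corner) and the first column `c` (off the corner). -/
def brow (g : GLm p (1 + l)) : Fin l → ZMod p := fun j => (g : Mat p (1 + l)) i0 (Fin.natAdd 1 j)

/-- The first column `c` of `g` (off the corner). -/
def ccol (g : GLm p (1 + l)) : Fin l → ZMod p := fun i => (g : Mat p (1 + l)) (Fin.natAdd 1 i) i0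

/-- Row `i` of `g (N;u)`: `g_{i0} N + Σ_j g_{i,1+j} u_j`. -/
theorem mulVec_vec_apply (g : Mat p (1 + l)) (N : ZMod p) (u : Fin l → ZMod p) (i : Fin (1 + l)) :
    (g *ᵥ vec N u) i = g i i0 * N + (fun j => g i (Fin.natAdd 1 j)) ⬝ᵥ u := by
  simp [Matrix.mulVec, dotProduct, Fin.sum_univ_add, vec, Fin.append_left, Fin.append_right, i0]

/-- For `g ∈ S`: `g (1;u) = (N;u)` iff `a + b·u = N` and `c = 0`. -/
theorem mulVec_vec_eq_iff {g : GLm p (1 + l)} (hg : g ∈ (slice : Set (GLm p (1 + l)))) (N : ZMod p) (u : Fin l → ZMod p) :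
    (g : Mat p (1 + l)) *ᵥ vec 1 u = vec N u ↔
      ((g : Mat p (1 + l)) i0 i0 + brow g ⬝ᵥ u = N ∧ ∀ i, ccol g i = 0) := by
  have hrow : ∀ i : Fin l, ((g : Mat p (1 + l)) *ᵥ vec 1 u) (Fin.natAdd 1 i) = ccol g i + u i := by
    intro i
    rw [mulVec_vec_apply, mul_one]
    have : (fun j => (g : Mat p (1 + l)) (Fin.natAdd 1 i) (Fin.natAdd 1 j)) ⬝ᵥ u = u i := by
      have e : (fun j => (g : Mat p (1 + l)) (Fin.natAdd 1 i) (Fin.natAdd 1 j)) =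
          fun j => (1 : Matrix (Fin l) (Fin l) (ZMod p)) i j := funext fun j => (mem_slice.mp hg) i j
      rw [e]
      simp [dotProduct, Matrix.one_apply, Finset.sum_ite_eq]
    rw [this]
    rfl
  have h0 : ((g : Mat p (1 + l)) *ᵥ vec 1 u) i0 = (g : Mat p (1 + l)) i0 i0 + brow g ⬝ᵥ u := by
    rw [mulVec_vec_apply, mul_one]
    rfl
  constructor
  · intro h
    refine ⟨?_, fun i => ?_⟩
    · have := congr_fun h i0
      rwa [h0, i0, vec_castAdd] at this
    · have := congr_fun h (Fin.natAdd 1 i)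
      rw [hrow, vec_natAdd] at this
      linear_combination this
  · rintro ⟨hN, hc⟩
    funext i
    refine Fin.addCases (fun i1 => ?_) (fun i => ?_) i
    · have hi1 : i1 = 0 := Subsingleton.elim _ _
      subst hi1
      rw [vec_castAdd]
      exact h0 ▸ hN
    · rw [hrow, vec_natAdd, hc i, zero_add]

/-- For `g ∈ S` with `c = 0`, the fibre indicator is `[a + b·u = N]`. -/
theorem fib_eq_of_ccol {g : GLm p (1 + l)} (hg : g ∈ (slice : Set (GLm p (1 + l)))) (hc : ∀ i, ccol g i = 0) (N : ZMod p)
    (u : Fin l → ZMod p) :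
    fib (vec 1 u) (vec N u) g = if (g : Mat p (1 + l)) i0 i0 + brow g ⬝ᵥ u = N then 1 else 0 := by
  simp only [fib, mulVec_vec_eq_iff hg, hc, implies_true, and_true]

/-- For `g ∈ S` with `c ≠ 0`, every fibre indicator `[g (1;u) = (N;u)]` vanishes. -/
theorem fib_eq_zero_of_ccol {g : GLm p (1 + l)} (hg : g ∈ (slice : Set (GLm p (1 + l)))) (hc : ¬ ∀ i, ccol g i = 0) (N : ZMod p)
    (u : Fin l → ZMod p) : fib (vec 1 u) (vec N u) g = 0 := by
  simp only [fib, mulVec_vec_eq_iff hg, hc, and_false, if_false]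

/-- In the slice, `b = 0` and `c = 0` force `a ≠ 0` (`g` is invertible). -/
theorem corner_ne_zero {g : GLm p (1 + l)} (hb : ∀ j, brow g j = 0) :
    (g : Mat p (1 + l)) i0 i0 ≠ 0 := by
  intro ha
  have hdet : (g : Mat p (1 + l)).det = 0 := by
    refine Matrix.det_eq_zero_of_row_eq_zero i0 fun j => ?_
    refine Fin.addCases (fun j1 => ?_) (fun j => ?_) j
    · have hj1 : j1 = 0 := Subsingleton.elim _ _
      subst hj1
      exact ha
    · exact hb j
  exact (Matrix.isUnits_det_units g).ne_zero hdet

/-- In the slice, `a = 1`, `b = 0`, `c = 0` means `g = 1`. -/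
theorem eq_one_of {g : GLm p (1 + l)} (hg : g ∈ (slice : Set (GLm p (1 + l)))) (ha : (g : Mat p (1 + l)) i0 i0 = 1)
    (hb : ∀ j, brow g j = 0) (hc : ∀ i, ccol g i = 0) : g = 1 := by
  refine Units.ext (Matrix.ext fun i j => ?_)
  rw [Units.val_one]
  refine Fin.addCases (fun i1 => ?_) (fun i' => ?_) i <;>
    refine Fin.addCases (fun j1 => ?_) (fun j' => ?_) j
  · have hi1 : i1 = 0 := Subsingleton.elim _ _
    have hj1 : j1 = 0 := Subsingleton.elim _ _
    subst hi1 hj1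
    rw [Matrix.one_apply_eq]
    exact ha
  · have hi1 : i1 = 0 := Subsingleton.elim _ _
    subst hi1
    rw [Matrix.one_apply_ne (fun h => by have := Fin.ext_iff.mp h; simp at this; omega)]
    exact hb j'
  · have hj1 : j1 = 0 := Subsingleton.elim _ _
    subst hj1
    rw [Matrix.one_apply_ne (fun h => by have := Fin.ext_iff.mp h; simp at this)]
    exact hc i'
  · rw [(mem_slice.mp hg) i' j', Matrix.one_apply, Matrix.one_apply]
    simp [Fin.natAdd_inj]

/-- `F(1) = p^l`. -/
theorem F_one : F (1 : GLm p (1 + l)) = (p : ℂ) ^ l := by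
  have h1 : ∀ u : Fin l → ZMod p, fib (vec 1 u) (vec 1 u) (1 : GLm p (1 + l)) = 1 := fun u => by
    simp [fib]
  have h2 : ∀ u : Fin l → ZMod p, fib (vec 1 u) (vec 0 u) (1 : GLm p (1 + l)) = 0 := fun u => by
    simp only [fib, Units.val_one, Matrix.one_mulVec]
    exact if_neg (vec_one_ne_vec_zero u)
  simp only [F, h1, h2, sub_zero, Finset.sum_const, Finset.card_univ, Fintype.card_pi,
    ZMod.card, Finset.prod_const, Fintype.card_fin, nsmul_eq_mul, mul_one, Nat.cast_pow]

/-- **`f(1) = 1`.** -/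
theorem f_one : f (1 : GLm p (1 + l)) = 1 := by
  have hp0 : (p : ℂ) ≠ 0 := Nat.cast_ne_zero.mpr hp.out.ne_zero
  rw [f, F_one, inv_mul_cancel₀ (pow_ne_zero l hp0)]

/-- **`F = 0` on `S ∖ {1}`.** -/
theorem F_eq_zero {g : GLm p (1 + l)} (hg : g ∈ (slice : Set (GLm p (1 + l)))) (hg1 : g ≠ 1) : F g = 0 := by
  by_cases hc : ∀ i, ccol g i = 0
  · simp only [F, fib_eq_of_ccol hg hc]
    by_cases hb : ∀ j, brow g j = 0
    · -- `b = 0`: the terms are `[a = 1] - [a = 0] = 0` since `a ≠ 0, 1`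
      have hbu : ∀ u : Fin l → ZMod p, brow g ⬝ᵥ u = 0 := fun u => by
        have : brow g = 0 := funext hb
        rw [this, zero_dotProduct]
      have ha0 := corner_ne_zero (g := g) hb
      have ha1 : (g : Mat p (1 + l)) i0 i0 ≠ 1 := fun ha => hg1 (eq_one_of hg ha hb hc)
      simp [hbu, ha0, ha1]
    · -- `b ≠ 0`: translate by `u₀` with `b·u₀ = 1`
      obtain ⟨j, hj⟩ := not_forall.mp hb
      set a := (g : Mat p (1 + l)) i0 i0
      let u₀ : Fin l → ZMod p := Pi.single j (brow g j)⁻¹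
      have hu₀ : brow g ⬝ᵥ u₀ = 1 := by
        simp only [u₀, dotProduct_single, mul_inv_cancel₀ hj]
      have hshift : ∑ u : Fin l → ZMod p, (if a + brow g ⬝ᵥ u = 1 then (1 : ℂ) else 0) =
          ∑ u : Fin l → ZMod p, (if a + brow g ⬝ᵥ u = 0 then (1 : ℂ) else 0) := by
        refine Fintype.sum_equiv (Equiv.subRight u₀) _ _ fun u => ?_
        have e : a + brow g ⬝ᵥ u = 1 ↔ a + brow g ⬝ᵥ (u - u₀) = 0 := by
          rw [dotProduct_sub, hu₀]
          constructor <;> intro h <;> linear_combination h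
        simp only [Equiv.subRight_apply, e]
      rw [Finset.sum_sub_distrib, hshift, sub_self]
  · simp only [F, fib_eq_zero_of_ccol hg hc, sub_self, Finset.sum_const_zero]

/-- **`f = 0` on `S ∖ {1}`.** -/
theorem f_eq_zero {g : GLm p (1 + l)} (hg : g ∈ (slice : Set (GLm p (1 + l)))) (hg1 : g ≠ 1) : f g = 0 := by
  rw [f, F_eq_zero hg hg1, mul_zero]

/-! ## The identity-test clause of the crux on slice triples (`k = 1`, `m = 1 + l`, all `p`) -/

/-- **Level-one identity designs on the block slice, all `m = 1 + l`, all `p`.**  If the triple products of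
`H₁ H₂ H₃ ≤ GL_{1+l}(𝔽_p)` lie in `S`, the identity-test clause of `SubgroupIdentityDesigns` holds at
`k = 1` (verbatim: a coefficient table supported on rank `≤ 1` whose Fourier function is `1` at `1` and `0`
at every triple product `≠ 1`). -/
theorem design_of_slice {H₁ H₂ H₃ : Subgroup (GLm p (1 + l))}
    (hS : ∀ a ∈ H₁, ∀ b ∈ H₂, ∀ c ∈ H₃, a * b * c ∈ (slice : Set (GLm p (1 + l)))) :
    ∃ c : Mat p (1 + l) → ℂ, (∀ M, 1 < M.rank → c M = 0) ∧
      (∑ M : Mat p (1 + l), c M * ZMod.stdAddChar (Matrix.trace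
        (M * ((1 : GLm p (1 + l)) : Mat p (1 + l))))) = 1 ∧
      ∀ a ∈ H₁, ∀ b ∈ H₂, ∀ g ∈ H₃, a * b * g ≠ 1 →
        (∑ M : Mat p (1 + l), c M * ZMod.stdAddChar (Matrix.trace
          (M * ((a * b * g : GLm p (1 + l)) : Mat p (1 + l))))) = 0 := by
  obtain ⟨c, hc, hf⟩ := (f_mem : (f : GLm p (1 + l) → ℂ) ∈ levelSet p (1 + l) 1)
  refine ⟨c, hc, ?_, fun a ha b hb g hg hne => ?_⟩
  · have h := hf 1
    rw [f_one] at h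
    exact h.symm
  · have h := hf (a * b * g)
    rw [f_eq_zero (hS a ha b hb g hg) hne] at h
    exact h.symm

/-- **The same for a conjugate slice `x S x⁻¹`** (test function `g ↦ f(x⁻¹ g x)`, level `≤ 1` by two-sided
translation invariance `levelSet_transl`): the slice hypothesis is literally that of
`BlockSliceConditional.volume_lt_cube` / `not_budget_lt_of_slice_eps` at `k = 1`. -/
theorem design_of_conjSlice {H₁ H₂ H₃ : Subgroup (GLm p (1 + l))} (x : GLm p (1 + l))
    (hS : ∀ a ∈ H₁, ∀ b ∈ H₂, ∀ c ∈ H₃, ∀ i j : Fin l,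
      ((x⁻¹ * (a * b * c) * x : GLm p (1 + l)) : Mat p (1 + l)) (Fin.natAdd 1 i) (Fin.natAdd 1 j) =
        (1 : Matrix (Fin l) (Fin l) (ZMod p)) i j) :
    ∃ c : Mat p (1 + l) → ℂ, (∀ M, 1 < M.rank → c M = 0) ∧
      (∑ M : Mat p (1 + l), c M * ZMod.stdAddChar (Matrix.trace
        (M * ((1 : GLm p (1 + l)) : Mat p (1 + l))))) = 1 ∧
      ∀ a ∈ H₁, ∀ b ∈ H₂, ∀ g ∈ H₃, a * b * g ≠ 1 →
        (∑ M : Mat p (1 + l), c M * ZMod.stdAddChar (Matrix.trace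
          (M * ((a * b * g : GLm p (1 + l)) : Mat p (1 + l))))) = 0 := by
  obtain ⟨c, hc, hf⟩ := levelSet_transl (f_mem : (f : GLm p (1 + l) → ℂ) ∈ levelSet p (1 + l) 1) x x⁻¹
  refine ⟨c, hc, ?_, fun a ha b hb g hg hne => ?_⟩
  · have h : f (x⁻¹ * 1 * x) = fourierFn c 1 := hf 1
    rw [mul_one, inv_mul_cancel, f_one] at h
    exact h.symm
  · have h : f (x⁻¹ * (a * b * g) * x) = fourierFn c (a * b * g) := hf (a * b * g)
    have hne' : x⁻¹ * (a * b * g) * x ≠ 1 := fun h1 => hne (by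
      have e : a * b * g = x * (x⁻¹ * (a * b * g) * x) * x⁻¹ := by group
      rw [h1, mul_one, mul_inv_cancel] at e
      exact e)
    have hmem : x⁻¹ * (a * b * g) * x ∈ (slice : Set (GLm p (1 + l))) := mem_slice.mpr (hS a ha b hb g hg)
    rw [f_eq_zero hmem hne'] at h
    exact h.symm

end BlockSliceDesignOne
end Summit.MatrixMultiplication.MatrixMultiplication.Theorems.SubgroupIdentityDesigns.Negative

end
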